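import Summits.BirchSwinnertonDyer.Rank1Residual.Supersingular.BlindPointFlatTwo
import Literature.NumberTheory.EllipticCurves.QuadraticTwist
import Literature.NumberTheory.EllipticCurves.BSDRootNumberSmallConductorProofs
import Literature.NumberTheory.EllipticCurves.Rank1Residual.Predicates
import Literature.NumberTheory.EllipticCurves.GlobalMinimalModel
import Literature.NumberTheory.EllipticCurves.FormalGroup
import Literature.NumberTheory.EllipticCurves.PadicFormalLogOrder
import Literature.NumberTheory.EllipticCurves.BSDInvariants
import HarnessLib

/-!
# -an g39 · §43 — THE EXACT ψ₂-DICTIONARY: `L♭₂(E)(ψ₂)·⟨ω,φω⟩·log₂γ = 8·#Ш(E₂)·Tam(E₂)·log(P₂)²/[E₂(ℚ):ℤP₂]²`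
(P-an-43A `FlatBlindGrossZagierAtChi8`, κ₀ = −4/log₂γ universal) and the repaired Katz depth law 42D′
(`KatzFrobeniusDepthLawA1`, REF1 R377a).

Crux `ByReductionTypeAtTwo.RankOneAtTwoBigImageOddLocal` (stmt-BirchSwinnertonDyer-23715); cell bsd-f1-sign2, lens
analytic / Waldspurger–Gross–Zagier.  This file STATES two conjecture-grade Props over tree declarations (no
placeholders, no axioms, no instances); evidence = `Cruxes/RankOneAtTwoBigImageOddLocal/CensusAN45.md`.  It continues
AN52 (40A/40B valuation law), AN53 (41S), AN54 (42A/42B/42V), AN55 (42C, L-42, L-42′; 42D killed), AN56 (42E):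
43A is the statement of which 40A, 41S, 42C, 42E are the valuation / mod-4 / mod-16 / mod-32 shadows.

ENGINES (kit tag `bsd-frontier-data`): (48) overconvergent modular symbols at p = 2 — PARI `mspadicinit(M,2,32,1)`,
`mstooms`, raw moments `msomseval` on the cosets `c + 8ℤ₂`, `c + 16ℤ₂` (χ₈ integrated directly; PARI's packaged
`mspadicmoments` refuses conductor 8 and its `mspadicseries` loses 4 bits/degree at p = 2), Sprung's half-logarithm
derivative at `T = −2` in `K = ℚ₂(α)`, elimination of the height coordinate between α and β ⇒ `b` and `s′ = L♯′(−2)`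
to 30–31 bits (level-8 and level-16 evaluations agree to ≥ 30 bits; `b ∈ ℚ₂` exactly; even-locus law
`5·b = −a₂·θ₁(−2)`-shape reproduced to 29–31 bits on 30/30 controls, `b = 0` exactly at a₂ = 0; census42 unit
mod 16 reproduced on every odd row); (49) Katz–ASD Frobenius at 2 with `K = 22` squarings (FLINT) ⇒ `m₂₁ mod 2¹²`;
(47, g38) `ellpadiclog` of the twist generator, two methods agreeing to ≥ 90 bits.

PARTITION 4/4/3/1 unchanged; beyond-print theorem: no (conjectures + data); BSD is not proved here.
-/

noncomputable section

open scoped Classical MatrixGroups ModularForm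

open PowerSeries WeierstrassCurve CongruenceSubgroup Literature.NumberTheory.EllipticCurves
  Literature.NumberTheory.EllipticCurves.ModularForms Literature.NumberTheory.EllipticCurves.Sprung2017
  Literature.NumberTheory.EllipticCurves.Rank1Residual
  Summit.BirchSwinnertonDyer.Rank1Residual.Supersingular
  Summit.BirchSwinnertonDyer.Rank1Residual.Supersingular.BlindLever


namespace Summit.BirchSwinnertonDyer.Cruxes.RankOneAtTwoBigImageOddLocal.BlindGZAN57

/-! Mirror of the Katz-column definitions of `BlindFlatUnitKatzAN55` / `BlindFlatUnitLogSquareAN56`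
(same text; those crux workfiles are not built on the farm, so they cannot be imported).  R377c
normalisation note: the basis is `(ω, η)` with `ω = dx/(2y + a₁x + a₃)` the invariant differential and
`η = x·ω` for the coordinate `x` OF THE GIVEN MODEL `V`; under `x = x′ + r` one has `η′ = η − r·ω`, so
`m₁₁′ = m₁₁ + r·m₂₁`, `m₂₂′ = m₂₂ − r·m₂₁`, while `m₂₁`, `m₁₂ + …`, the trace and the determinant are
model-invariants (REF1-AUDIT §377 K377.9). -/

/-- `f₂ = ∫η` regularised: `Σ_{N ≥ 1} (d(N)/N) z^N`, `d(N) = coeff (N+1) (z²x(z)·ω(z)/dz)`.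
[Katz 1981 §5] [folklore] -/
def formalEtaIntegral {A : Type*} [CommRing A] [Algebra ℚ A] (V : WeierstrassCurve A) : A⟦X⟧ :=
  PowerSeries.mk fun N =>
    if N = 0 then 0 else algebraMap ℚ A (1 / (N : ℚ)) * coeff (N + 1) (V.formalXMulSq * V.formalOmega)

/-- The Frobenius lift `f(z) ↦ f(z²)`. [Katz 1981 §3] [folklore] -/
def frobTwo {A : Type*} [CommRing A] (g : A⟦X⟧) : A⟦X⟧ :=
  PowerSeries.mk fun n => if 2 ∣ n then coeff (n / 2) g else 0

/-- `2`-adic integrality of a power series over `ℚ_[2]`. [folklore] -/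
def IsTwoAdicIntegral (g : ℚ_[2]⟦X⟧) : Prop := ∀ n : ℕ, ‖coeff n g‖ ≤ 1

/-- Katz's first Frobenius column `(m₁₁, m₂₁)` of `φ` on `D(Ê)` in the basis `(ω, η = x·ω)` of the
model `V`: `F(log_V) − m₁₁·log_V − m₂₁·f₂` is `2`-integral (`c(N)m₁₁ + d(N)m₂₁ ≡ 2c(N/2) mod 2^{v₂N}`).
[Katz 1981 §5 / ASD congruences] [folklore] -/
def IsKatzFrobeniusColumn (V : WeierstrassCurve ℚ_[2]) (m₁₁ m₂₁ : ℤ_[2]) : Prop :=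
  IsTwoAdicIntegral
    (frobTwo V.formalLog - C (m₁₁ : ℚ_[2]) * V.formalLog - C (m₂₁ : ℚ_[2]) * formalEtaIntegral V)

/-- Katz's second Frobenius column `(m₁₂, m₂₂)`: `F(f₂) − m₁₂·log_V − m₂₂·f₂` is `2`-integral.
[Katz 1981 §5] [folklore] -/
def IsKatzFrobeniusSecondColumn (V : WeierstrassCurve ℚ_[2]) (m₁₂ m₂₂ : ℤ_[2]) : Prop :=
  IsTwoAdicIntegral
    (frobTwo (formalEtaIntegral V) - C (m₁₂ : ℚ_[2]) * V.formalLog - C (m₂₂ : ℚ_[2]) * formalEtaIntegral V)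

/-- `log₂ γ ∈ ℚ_[2]`: the `2`-adic logarithm of the tree's cyclotomic generator
`γ = cyclotomicGenerator 2 = 1 + 2² = 5` (`PAdicLFunction.lean`), as the convergent series
`log(1 + 4) = −∑_{k ≥ 1} (−4)^k / k`; `v₂(log₂ γ) = 2`, `−log₂ γ / 4 ≡ 1633`, `−4 / log₂ γ ≡ 3489 (mod 2¹²)`.
It enters because `b = L♭(−2)` is a value in the variable `T = γ^s − 1` while the Gross–Zagier side is a
derivative in `s`: `d/ds = log₂γ·(1+T)·d/dT` and `1 + T = −1` at `ψ₂`. [folklore] -/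
def logCycGenTwo : ℚ_[2] := ∑' k : ℕ, -((-4 : ℚ_[2]) ^ (k + 1)) / ((k : ℚ_[2]) + 1)

/-- **P-an-43A `FlatBlindGrossZagierAtChi8` (conjecture; -an g39 §43, the EXACT ψ₂-dictionary).**
For `E/ℚ` (globally minimal `W`, newform `f`, conductor `N` odd) with good supersingular reduction at `2`
(`a₂ ∈ {0, ±2}`) on the ODD-twist locus `w(E)·χ₈(N) = −1`, Sprung pair `(L♯, L♭)` at `2`, quadratic twist
`E₂ = E^{(2)}` (globally minimal `W₂`) of analytic rank `1` with finite `Ш`, Katz Frobenius entry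
`m₂₁ = ⟨ω, φω⟩`-coordinate of `φ(ω)` on `η = x·ω` (a model invariant, `v₂ = 1`), and ANY rational point `P`
of finite index `ι = [E₂(ℚ) : ℤP]` (torsion included in the index):
`L♭₂(E)(ψ₂) · m₂₁ · log₂γ · (ι·m₀)² = 8 · Tam(E₂) · #Ш(E₂) · log_{Ê₂}(m₀·P)²`
(`m₀ = formalIndex W₂ 2`, `log_{Ê₂}` = `padicLogPoint` of the minimal model, `b = evalAt (−2) L♭` in tree
units).  Equivalently `b = −2κ₀ · #Ш · Tam · log(P)² / (ι² · m₂₁)` with the UNIVERSAL constant `κ₀ = −4 / log₂ γ`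
(`m₀` cancels: `b·m₂₁·log₂γ·ι² = 8·Tam·#Ш·log(P)²`).  EVIDENCE (BC5 witness = CensusAN45): three independent
engines — `b` to 30–31 bits
from overconvergent modular symbols at `p = 2` (PARI `mspadicinit/mstooms/msomseval`, χ₈-cosets integrated
directly; calibrated EXACTLY on the even locus, 30/30, and against census42's unit mod 16, 954/954),
`m₂₁ mod 2¹²` from Katz–ASD congruences (`K = 22`), `log` from `ellpadiclog` — the quotient
`R(E) = b·m₂₁·ι²/(−2·Tam·Ш·log²)` is ≡ 1441 (mod 2¹¹) = `−4/log₂γ mod 2¹¹` on 954/954 rows (a₂ = −2/0/+2: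
244/465/245; N ≤ 7809; Tam(E₂) takes 39 values; 0 outliers at every bit), uniformly in `a₂ ∈ {0, ±2}` (κ₀ = −4/log₂γ
was PRE-REGISTERED from the variable change before the join; the rival
candidates `1`, `−log₂γ/4` agree mod 32 and are excluded at bit 5).  COROLLARIES: 40A/40B (valuation
`v₂(b) = v₂(#Ш·Tam) + 2ℓ`: `v₂(8) − v₂(log₂γ) − v₂(m₂₁) = 0`), 41S/42C/42E (unit laws mod 4/16/32) and, with
L-42, 42A/42B.  WHY IT MIGHT FAIL AS TYPED: (i) only 11–12 bits of κ₀ are measured (a constant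
`κ₀′ ≡ κ₀ (mod 2¹²)`, e.g. `κ₀·(1 + 2¹²u)`, is not excluded — the statement bets on the clean constant);
(ii) torsion enters only through `ι` (all census twists have trivial torsion); (iii) rows with
`ℓ = ord log − v₂ ι > 0` are a minority; (iv) normalisations of `IsSprungPair`/`evalAt` at `p = 2` (a global
sign or power of 2 would move the `8`).  WHY NOVEL: a p-adic Gross–Zagier/Rubin formula at `p = 2`, at a
character OUTSIDE the interpolation range (the blind quadratic character), for supersingular reduction with
`a₂ = ±2` allowed, whose period side is the twist's: Kobayashi 2013 (Invent. 191) Thm 1.1/Cor 1.3 is `p` odd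
(p. 605 «a_p ≠ 2 since p is odd»), trivial character; no statement for `L♭(ψ₂)` exists in print or tree
(corpus fts+vec, galaxy: 0); REF2 v70-add1: «NOT IN PRINT at any finite-order wild character for any p; VARIANT-TRANSPLANT
of Kobayashi 2013 Thm 1.1» (REF2 will compare the pinned constant with Cor 1.3(ii)'s `(1 − 1/α)²` — here the α-dependence
was eliminated between the two roots and what survives is `8/log₂γ` and ⟨ω,φω⟩).  REGIME FACTS (REF1 §380/§381): the wild
twist E₂ has Kodaira type II at 2, `c₂ = 1`, `f₂ = 6`, `m₀ = formalIndex W₂ 2 = 2`, and `E₂(ℚ)_tors = 1` on every census row;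
`#Ш(E₂)_odd = 1` on all rows (untested otherwise — R380a data ask)  Sources: Kobayashi2013
doi:10.1007/s00222-012-0400-9; Sprung arXiv:1601.00010;
Pollack–Stevens 2011 (OMS); Katz 1981 (acq-14939); CensusAN45 (kit j341244/265/311/268/269/270 ⊗ j341251/252,
tag bsd-frontier-data). -/
@[conjecture] def FlatBlindGrossZagierAtChi8 : Prop :=
  ∀ (W : WeierstrassCurve ℚ) [W.IsElliptic] [W.IsGloballyMinimal] [NeZero (W.conductorNorm ℤ)]
    (f : CuspForm (Gamma0 (W.conductorNorm ℤ)) 2), IsNewformOf W f → GoodSS W 2 →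
    W.rootNumber * ZMod.χ₈ (W.conductorNorm ℤ : ZMod 8) = -1 →
    ∀ (Ls Lf : IwasawaAlgebra 2), IsSprungPair f 2 (W.frobeniusTrace 2) Ls Lf →
    ∀ (W₂ : WeierstrassCurve ℚ) [W₂.IsElliptic] [W₂.IsGloballyMinimal],
      (∃ C : WeierstrassCurve.VariableChange ℚ, C • W.quadraticTwist 2 = W₂) →
      W₂.analyticRank = 1 → W₂.shaOrder ≠ 0 →
    ∀ (m₁₁ m₂₁ : ℤ_[2]), IsKatzFrobeniusColumn (W.map (Rat.castHom ℚ_[2])) m₁₁ m₂₁ →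
    ∀ (P : (W₂.baseChange ℚ).toAffine.Point) (ι : ℕ),
      (AddSubgroup.zmultiples P).index = ι → ι ≠ 0 →
      ((evalAt (-2 : ℤ_[2]) Lf : ℤ_[2]) : ℚ_[2]) * (m₂₁ : ℚ_[2]) * logCycGenTwo *
          ((ι : ℚ_[2]) * (formalIndex W₂ 2 : ℚ_[2])) ^ 2 =
        8 * (W₂.tamagawaProduct : ℚ_[2]) * (W₂.shaOrder : ℚ_[2]) *
          ((W₂.baseChange ℚ_[2]).padicLogPoint
              (formalIndex W₂ 2 • padicPointOf W₂ 2 (Rat.castHom ℚ_[2]) P)) ^ 2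

/-- **42D′ `KatzFrobeniusDepthLawA1` (conjecture; the REPAIRED depth law — REF1-AUDIT §377 rider R377a).**
The killed P-an-42D `KatzFrobeniusDepthLaw` (AN55; refuted-misstated, REF1 K377.9: under `x = x′ + r` the
diagonal moves by `±r·m₂₁` with `v₂(m₂₁) = 1`, so two globally minimal models congruent mod `2^k` can differ
mod `2^{k+1}` on `(m₁₁, m₂₂)`) is NOT re-worded in place; this is REF1's repair `C′` under a NEW name: the same
conclusion — the whole Katz Frobenius matrix mod `2^{k+1}` in the basis `(ω, η = x·ω)` OF THE MODEL — from
coefficientwise congruence of the two globally minimal models mod `2^k` PLUS `a₁ ≡ a₁′ (mod 2^{k+1})`.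
EVIDENCE (CensusAN45 §5, kit j341249, engine49 on the GIVEN models, `K = 20`, matrices to 11 bits): 270/270
random globally-minimal pairs (30 per `k`, `k = 1…9`) satisfy the conclusion mod `2^{k+1}` (extra depth beyond
`k+1`: 0 on 205, 1 on 51, 2 on 11, 3 on 3 — the law is sharp), and 90/90 controls with `a₁ − a₁′ = 2^k·odd`
(all other coefficients ≡ mod `2^k`) VIOLATE it, always on the diagonal `(m₁₁, m₂₂)` at bit `k` exactly while
`m₂₁, m₁₂` agree to ≥ `k+1` bits — REF1's 400/400 at `k ≤ 3` extended to `k ≤ 9`.  WHY IT MIGHT FAIL: a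
congruence class at larger `k` where `a₃`, not `a₁`, drives an extra half-bit (none seen); the quantifier over ALL
globally minimal models includes non-reduced ones (tested: the random models are non-reduced).  Basis /
normalisation: see the note above `formalEtaIntegral` (R377c).  PLACEMENT (REF2 v70-add1): C′ is a lemma with a complete
paper proof — Berthelot–Ogus 1978 Thm 7.24 / Cor 7.25 / 7.26.3 (A = ℤ₂ allowed, e = 1 ≤ p − 1) with Katz 1981 Thm 5.9.5 /
Cor 5.9.6 / Thm 6.1 (REF2 v70 §1.4); sharp: no mod 2^(k+2) version.  Tagged conjecture here only because it is not yet a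
tree theorem. [cite: BerthelotOgus1978 7.24–7.26; Katz1981 5.9.6, 6.1; REF1-AUDIT §377] -/
@[conjecture] def KatzFrobeniusDepthLawA1 : Prop :=
  ∀ (k : ℕ), 1 ≤ k →
  ∀ (W W' : WeierstrassCurve ℚ) [W.IsElliptic] [W'.IsElliptic] [W.IsGloballyMinimal] [W'.IsGloballyMinimal],
    GoodSS W 2 → GoodSS W' 2 →
    (integralModelInt W).a₁ ≡ (integralModelInt W').a₁ [ZMOD 2 ^ (k + 1)] →
    (integralModelInt W).a₂ ≡ (integralModelInt W').a₂ [ZMOD 2 ^ k] →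
    (integralModelInt W).a₃ ≡ (integralModelInt W').a₃ [ZMOD 2 ^ k] →
    (integralModelInt W).a₄ ≡ (integralModelInt W').a₄ [ZMOD 2 ^ k] →
    (integralModelInt W).a₆ ≡ (integralModelInt W').a₆ [ZMOD 2 ^ k] →
    ∀ (m₁₁ m₂₁ m₁₂ m₂₂ n₁₁ n₂₁ n₁₂ n₂₂ : ℤ_[2]),
      IsKatzFrobeniusColumn (W.map (Rat.castHom ℚ_[2])) m₁₁ m₂₁ →
      IsKatzFrobeniusSecondColumn (W.map (Rat.castHom ℚ_[2])) m₁₂ m₂₂ →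
      IsKatzFrobeniusColumn (W'.map (Rat.castHom ℚ_[2])) n₁₁ n₂₁ →
      IsKatzFrobeniusSecondColumn (W'.map (Rat.castHom ℚ_[2])) n₁₂ n₂₂ →
        PadicInt.toZModPow (k + 1) m₁₁ = PadicInt.toZModPow (k + 1) n₁₁ ∧
        PadicInt.toZModPow (k + 1) m₂₁ = PadicInt.toZModPow (k + 1) n₂₁ ∧
        PadicInt.toZModPow (k + 1) m₁₂ = PadicInt.toZModPow (k + 1) n₁₂ ∧
        PadicInt.toZModPow (k + 1) m₂₂ = PadicInt.toZModPow (k + 1) n₂₂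

end Summit.BirchSwinnertonDyer.Cruxes.RankOneAtTwoBigImageOddLocal.BlindGZAN57

end
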